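/-
Copyright (c) 2026 the pub-hodgecm-mathlib formalisation cell (harness21).  Prover seat hodgecm-mathlib-R90-C131-p01 (g3) on S6 dealer R90-C14-plan (g3)'s DEAL
2026-09-05T03:38:49Z (chair K2-lead (g2) VALVE 34 (oo)), R90-TF section S6 «Ch. 14.1–14.5 stable trace formula» (h413 = `stmt-HodgeConjecture-24833`): CARD (T4.0)
«TWISTED SHELL FINITE» — the three finiteness targets (T4.0a)∕(T4.0b)∕(T4.0c) of typ2 (g3)'s TARGET SHEET (v1 9b41a296748720e8 §1 :79–:100 ∕ v2
8dacb7777119425b §1 :110–:118) `R90/R90-C14-typ2/g3/S6_T4_TwistedEllipticCount_Targets.v{1,2}.lean`, statements VERBATIM (dealer RULINGS #3 (R20), #4 (R23)(i), #9).  THEOREMS ONLY (no `def`, no `instance`, no notation, no named-fact hypothesis, no `sorry`); ★-only imports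
(Literature + Mathlib), NO `Lines` import, NO sheet import.
-/
import Literature.NumberTheory.Rogawski1990.Ch4Sec10                          -- ★ `epsCentralizer` (the ε-centraliser `G̃_{δε}` as `MonoidHom.eqLocus (Ad δ⁻¹) ε`)
import Literature.NumberTheory.Automorphic.ReductiveGroupData                   -- ★ `glInt N K = GL_N(𝒪)`
import Literature.NumberTheory.Automorphic.IwasawaDecompositionGL               -- ★ `zpowDiagGL` (the Cartan representative `ϖ^a`)
import Literature.NumberTheory.Automorphic.HeckeTransversalGL                   -- ★ `IsUniformizingElement`
import Literature.NumberTheory.Automorphic.U3LocalBruhatDecompositionProofs     -- ★ `UnitaryGroup.qsInvolution` (`Θ_σ`)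
import Mathlib.Topology.Algebra.Group.OpenMapping                               -- Mathlib: `isOpenMap_smul_of_sigmaCompact` (open mapping theorem for orbit maps)
import HarnessLib

/-!
# R90-TF · S6 «Ch. 14.1–14.5», (T4.0) TWISTED SHELL FINITE — the `hfin` binder of the twisted shell counts, DISCHARGED
# (Kottwitz 1986 §1 p. 240; Rogawski 1990 §1.4 p. 4, §4.10 p. 56)

Cell `hodgecm-mathlib`, crux H413 (`stmt-HodgeConjecture-24833`, lane `--supports … --as helper`), route of record `HCCMUnconditional` (no route verbs;
count-neutral).  Programme R90-TF, section S6, DAG row E1.4.4.2.2 (twisted shell counts at an elliptic `G`-regular norm); S6 dealer R90-C14-plan (g3), SPEC AUTHORITY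
typ2 (g3) (TARGET SHEET v1 9b41a296748720e8 §1).  CONSUMERS: the `hfin` binder carried by ★ J1′ (:270), ★ L4, ★ K7 and K8 (S.1) (`epsOrbitalIntegral` of the
indicator of a Cartan shell `K̃ϖ^aK̃` = `(ν K̃).toReal * #Shell(δ′, a)` under `hfin : (Shell(δ′, a)).Finite`).

THE MATHEMATICS.  `G = GL_N(K)`, `K̃ = GL_N(𝒪)` (★ `glInt`), twist `Θ` (an endomorphism `ε` of `G`; at S6 `ε = Θ_σ =` ★ `UnitaryGroup.qsInvolution σ`), base point
`δ′`, twisted orbit map `F(g) = g⁻¹ δ′ ε(g)`, the TWISTED SHELL `Shell(δ′, a) = {q ∈ G ⧸ K̃ : F(q.out) ∈ K̃ ϖ^a K̃}`.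
* (T4.0a) `twistedShell_finite_of_isCompact_preimage`: if `P = F⁻¹(K̃ϖ^aK̃)` is compact and `K̃` is open, `Shell(δ′, a)` is FINITE — `P` is covered by the open
  left cosets `gK̃`, finitely many suffice, and every `q` in the shell has `q.out ∈ P`, hence `q = gK̃` for one of those finitely many `g`.
* (T4.0b) `isCompact_preimage_twistedConj_of_isClosed_range`: for `G` locally compact second countable (hence σ-compact), `ε` continuous, the ε-centraliser
  `Z = G̃_{δ′ε}` (★ `epsCentralizer`) compact and the twisted orbit `O = {g⁻¹δ′ε(g)}` CLOSED, the map `F` is PROPER.  Proof: `G` acts on the closed — hence locally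
  compact Hausdorff, hence Baire — orbit `O` by the twisted action `g • x = g x ε(g)⁻¹`, continuously and transitively; by the OPEN MAPPING THEOREM for orbit maps of
  σ-compact groups (Mathlib `isOpenMap_smul_of_sigmaCompact`, Effros∕Arens) the orbit map `φ(g) = g • δ′` is open.  With a compact neighbourhood `V` of `1`, the sets
  `φ(g·V°)` are open and cover the compact trace `C ∩ O`; finitely many `g_i` suffice, and `φ⁻¹(C) ⊆ ⋃ g_i V Z` (the fibres of `φ` are the cosets `gZ`), a compact
  set; `φ⁻¹(C)` is closed, hence compact; finally `F(g) = φ(g⁻¹)`.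
* (T4.0c) `twistedShell_finite_of_compactSpace_epsCentralizer` = (T4.0b) ∘ (T4.0a) at the compact Cartan shell `K̃ϖ^aK̃`: the CONSUMER-FACING `hfin` (K8 (S.1), ★ J1′∕L4∕K7),
  under `K̃` compact open, `ε = Θ_σ` pointwise, compact ε-centraliser, closed twisted orbit (SHEET v2 §1 :110–:118).
HONEST LABEL: HC_CM is proved only modulo the 7 printed citations (2 remaining named inputs: hLiu418 = stmt-HodgeConjecture-24832, h413 =
stmt-HodgeConjecture-24833) until rung 0 closes; finiteness plumbing for E1.4.4.2.2, count-neutral; this file pays no crux socket (REL ≠ ★ ≠ BUILT).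

## References
* [Kottwitz1986BaseChangeUnits] R. Kottwitz, *Base change for unit elements of Hecke algebras*, Compositio Math. 60 (1986), §1 p. 240 (twisted orbital integrals
  of units as finite lattice counts).
* [Rogawski1990] J. D. Rogawski, *Automorphic Representations of Unitary Groups in Three Variables*, Ann. of Math. Stud. 123 (1990), §1.4 p. 4 (ε-centralisers,
  ε-semisimple elements), §4.10 p. 56 (twisted orbital integrals).
* [BernsteinZelevinsky1976] I. N. Bernstein, A. V. Zelevinsky, Russian Math. Surveys 31:3 (1976), §1.1 (open compact subgroups, discrete coset spaces).
-/

set_option autoImplicit false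
-- the mandated namespace repeats the single-problem summit's segment (`HodgeConjecture.HodgeConjecture`)
set_option linter.dupNamespace false

noncomputable section

open Topology Set Filter
open scoped Pointwise MatrixGroups Matrix Valued WithZero
open Literature.NumberTheory.Automorphic Literature.NumberTheory.Rogawski1990.Ch4Sec10

namespace Summit.HodgeConjecture.HodgeConjecture.R90.S6

section Finite

variable {K : Type} [Field K] [Valued K ℤᵐ⁰] [ValuativeRel K] [(Valued.v : Valuation K ℤᵐ⁰).Compatible] {σ : K →+* K} {N : ℕ} {ϖ : K}
  (hϖ : IsUniformizingElement ϖ)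

omit [(Valued.v : Valuation K ℤᵐ⁰).Compatible] in
/-- **(T4.0a) A COMPACT PREIMAGE MEETS FINITELY MANY COSETS.**  If the preimage of the Cartan shell `K̃ϖ^aK̃` under the twisted orbit map `g ↦ g⁻¹·δ′·Θ_σ(g)` is compact and
`K̃ = GL_N(𝒪)` is open, then the twisted shell `Shell(δ′, a)` (★ J1′'s set of cosets) is FINITE: the preimage is covered by the open left cosets `gK̃`, finitely many of them
suffice (compactness), and every `q` of the shell has `q.out` in the preimage, so `q = gK̃` for one of those finitely many `g` (`QuotientGroup.eq`).
[cite: Kottwitz1986BaseChangeUnits, §1 p. 240] [cite: Rogawski1990, §4.10 p. 56] [cite: BernsteinZelevinsky1976, §1.1] -/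
theorem twistedShell_finite_of_isCompact_preimage (δ' : GL (Fin N) K) (a : Fin N → ℤ) (hK : IsOpen (glInt N K : Set (GL (Fin N) K)))
    (hcpt : IsCompact ((fun g : GL (Fin N) K => g⁻¹ * δ' * UnitaryGroup.qsInvolution σ g) ⁻¹'
      ((glInt N K : Set (GL (Fin N) K)) * {zpowDiagGL hϖ.ne_zero a} * (glInt N K : Set (GL (Fin N) K))))) :
    {q : GL (Fin N) K ⧸ glInt N K |
      q.out⁻¹ * δ' * UnitaryGroup.qsInvolution σ q.out ∈
        (glInt N K : Set (GL (Fin N) K)) * {zpowDiagGL hϖ.ne_zero a} * (glInt N K : Set (GL (Fin N) K))}.Finite := by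
  classical
  -- the open cover of the preimage by left cosets `{x | g⁻¹ x ∈ K̃}`
  have hUo : ∀ g : GL (Fin N) K, IsOpen {x : GL (Fin N) K | g⁻¹ * x ∈ glInt N K} := fun g =>
    hK.preimage (continuous_const.mul continuous_id)
  have hcov : (fun g : GL (Fin N) K => g⁻¹ * δ' * UnitaryGroup.qsInvolution σ g) ⁻¹'
      ((glInt N K : Set (GL (Fin N) K)) * {zpowDiagGL hϖ.ne_zero a} * (glInt N K : Set (GL (Fin N) K))) ⊆
      ⋃ g : GL (Fin N) K, {x : GL (Fin N) K | g⁻¹ * x ∈ glInt N K} := fun x _ =>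
    Set.mem_iUnion.2 ⟨x, by rw [Set.mem_setOf_eq, inv_mul_cancel]; exact Subgroup.one_mem _⟩
  obtain ⟨t, ht⟩ := hcpt.elim_finite_subcover _ hUo hcov
  -- every shell coset is `gK̃` for some `g ∈ t`
  refine ((t.finite_toSet).image (QuotientGroup.mk : GL (Fin N) K → GL (Fin N) K ⧸ glInt N K)).subset ?_
  intro q hq
  obtain ⟨g, hg, hgq⟩ := Set.mem_iUnion₂.1 (ht hq)
  refine ⟨g, hg, ?_⟩
  rw [← QuotientGroup.out_eq' q]
  exact QuotientGroup.eq.2 hgq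

omit [ValuativeRel K] [(Valued.v : Valuation K ℤᵐ⁰).Compatible] in
/-- **(T4.0b) COMPACT ε-CENTRALISER + CLOSED TWISTED ORBIT ⇒ THE TWISTED ORBIT MAP IS PROPER.**  For `GL_N(K)` locally compact second countable, `Θ = ε` a continuous
endomorphism, the ε-centraliser `G̃_{δ′Θ}` (★ `epsCentralizer`) compact and the twisted orbit `{g⁻¹δ′Θ(g)}` CLOSED (ε-semisimple `δ′`: e.g. `N δ′` regular semisimple), the
preimage of every compact set under `g ↦ g⁻¹δ′Θ(g)` is compact.  PROOF: `GL_N(K)` (σ-compact) acts on the closed, hence locally compact Hausdorff, hence Baire, orbit by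
`g • x = g x Θ(g)⁻¹`, continuously and transitively, so the orbit map `φ(g) = g • δ′` is OPEN (Mathlib `isOpenMap_smul_of_sigmaCompact` — the open mapping theorem for
homogeneous spaces of σ-compact groups); cover the compact trace `C ∩ orbit` by finitely many open sets `φ(g_i V°)` (`V` a compact neighbourhood of `1`); then
`φ⁻¹(C) ⊆ ⋃ g_i V G̃_{δ′Θ}` is closed inside a compact set; and `g ↦ g⁻¹δ′Θ(g)` is `φ ∘ (·)⁻¹`.  Feeds (T4.0a).
[cite: Rogawski1990, §1.4 p. 4, §4.10 p. 56] [cite: Kottwitz1986BaseChangeUnits, §1 p. 240] -/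
theorem isCompact_preimage_twistedConj_of_isClosed_range [LocallyCompactSpace (GL (Fin N) K)] [SecondCountableTopology (GL (Fin N) K)]
    (ε : GL (Fin N) K →* GL (Fin N) K) (hε : Continuous ⇑ε) (δ' : GL (Fin N) K) [CompactSpace (epsCentralizer ε δ')]
    (horb : IsClosed (Set.range fun g : GL (Fin N) K => g⁻¹ * δ' * ε g)) {C : Set (GL (Fin N) K)} (hC : IsCompact C) :
    IsCompact ((fun g : GL (Fin N) K => g⁻¹ * δ' * ε g) ⁻¹' C) := by
  classical
  -- the orbit, closed in `G`, as a subtype: locally compact, Hausdorff, Baire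
  set O : Set (GL (Fin N) K) := Set.range fun g : GL (Fin N) K => g⁻¹ * δ' * ε g with hO
  haveI : LocallyCompactSpace O := horb.isClosedEmbedding_subtypeVal.locallyCompactSpace
  -- the twisted LEFT action `g • x = g x ε(g)⁻¹` of `G` on the orbit (a local structure; no instance is declared)
  have hmem : ∀ (g x : GL (Fin N) K), x ∈ O → g * x * (ε g)⁻¹ ∈ O := by
    rintro g x ⟨y, rfl⟩
    exact ⟨y * g⁻¹, by simp only [map_mul, map_inv, mul_inv_rev, inv_inv, mul_assoc]⟩
  letI act : MulAction (GL (Fin N) K) O :=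
    { smul := fun g x => ⟨g * (x : GL (Fin N) K) * (ε g)⁻¹, hmem g x x.2⟩
      one_smul := fun x => Subtype.ext (by
        show (1 : GL (Fin N) K) * (x : GL (Fin N) K) * (ε 1)⁻¹ = x
        rw [map_one, inv_one, mul_one, one_mul])
      mul_smul := fun g h x => Subtype.ext (by
        show g * h * (x : GL (Fin N) K) * (ε (g * h))⁻¹ = g * (h * (x : GL (Fin N) K) * (ε h)⁻¹) * (ε g)⁻¹
        rw [map_mul, mul_inv_rev]
        simp only [mul_assoc]) }
  have hsmul : ∀ (g : GL (Fin N) K) (x : O), ((g • x : O) : GL (Fin N) K) = g * (x : GL (Fin N) K) * (ε g)⁻¹ := fun _ _ => rfl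
  haveI : ContinuousSMul (GL (Fin N) K) O :=
    ⟨(((continuous_fst).mul (continuous_subtype_val.comp continuous_snd)).mul ((hε.comp continuous_fst).inv)).subtype_mk _⟩
  haveI : MulAction.IsPretransitive (GL (Fin N) K) O :=
    ⟨fun x y => by
      obtain ⟨a, ha⟩ := x.2
      obtain ⟨b, hb⟩ := y.2
      refine ⟨b⁻¹ * a, Subtype.ext ?_⟩
      rw [hsmul, ← ha, ← hb, map_mul, map_inv]
      group⟩
  -- the base point and the (open!) orbit map
  let x₀ : O := ⟨δ', 1, by simp only [inv_one, map_one, one_mul, mul_one]⟩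
  let φ : GL (Fin N) K → O := fun g => g • x₀
  have hφ : ∀ g, ((φ g : O) : GL (Fin N) K) = g * δ' * (ε g)⁻¹ := fun g => rfl
  have hφc : Continuous φ := continuous_id.smul continuous_const
  have hopen : IsOpenMap φ := isOpenMap_smul_of_sigmaCompact x₀
  -- the fibres of `φ` are the cosets of the ε-centraliser
  have hstab : ∀ g h : GL (Fin N) K, φ h = φ g → g⁻¹ * h ∈ epsCentralizer ε δ' := by
    intro g h heq
    have h1 : h * δ' * (ε h)⁻¹ = g * δ' * (ε g)⁻¹ := by
      have := congrArg (fun z : O => (z : GL (Fin N) K)) heq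
      simpa only [hφ] using this
    show (MulAut.conj δ'⁻¹).toMonoidHom (g⁻¹ * h) = ε (g⁻¹ * h)
    rw [MulEquiv.coe_toMonoidHom, MulAut.conj_apply, inv_inv, map_mul, map_inv]
    calc δ'⁻¹ * (g⁻¹ * h) * δ' = δ'⁻¹ * g⁻¹ * (h * δ' * (ε h)⁻¹) * ε h := by group
      _ = δ'⁻¹ * g⁻¹ * (g * δ' * (ε g)⁻¹) * ε h := by rw [h1]
      _ = (ε g)⁻¹ * ε h := by group
  -- a compact neighbourhood of `1` and the finite open cover of the compact trace `C ∩ O`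
  obtain ⟨V, hVc, hV1⟩ := exists_compact_mem_nhds (1 : GL (Fin N) K)
  have hC' : IsCompact (Subtype.val ⁻¹' C : Set O) := horb.isClosedEmbedding_subtypeVal.isCompact_preimage hC
  let U : GL (Fin N) K → Set O := fun g => φ '' ((fun v => g * v) '' interior V)
  have hUo : ∀ g, IsOpen (U g) := fun g => hopen _ ((isOpenMap_mul_left g) _ isOpen_interior)
  have hcov : (Subtype.val ⁻¹' C : Set O) ⊆ ⋃ g, U g := by
    intro x _
    obtain ⟨y, hy⟩ := x.2
    have hy' : y⁻¹ * δ' * ε y = (x : GL (Fin N) K) := hy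
    refine Set.mem_iUnion.2 ⟨y⁻¹, ⟨y⁻¹ * 1, ⟨1, mem_interior_iff_mem_nhds.2 hV1, rfl⟩, Subtype.ext ?_⟩⟩
    rw [hφ, mul_one, ← hy', map_inv, inv_inv]
  obtain ⟨t, ht⟩ := hC'.elim_finite_subcover U hUo hcov
  -- `φ⁻¹(C) ⊆ ⋃_{g ∈ t} g · V · Z`, a compact set
  have hZc : IsCompact ((epsCentralizer ε δ' : Subgroup (GL (Fin N) K)) : Set (GL (Fin N) K)) := isCompact_iff_compactSpace.2 ‹_›
  have hpiece : ∀ g : GL (Fin N) K,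
      IsCompact ((fun p : GL (Fin N) K × GL (Fin N) K => g * p.1 * p.2) '' (V ×ˢ ((epsCentralizer ε δ' : Subgroup (GL (Fin N) K)) : Set (GL (Fin N) K)))) :=
    fun g => (hVc.prod hZc).image ((continuous_const.mul continuous_fst).mul continuous_snd)
  have hsub : (fun g : GL (Fin N) K => g * δ' * (ε g)⁻¹) ⁻¹' C ⊆
      ⋃ g ∈ t, (fun p : GL (Fin N) K × GL (Fin N) K => g * p.1 * p.2) '' (V ×ˢ ((epsCentralizer ε δ' : Subgroup (GL (Fin N) K)) : Set (GL (Fin N) K))) := by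
    intro h hh
    have hφh : φ h ∈ (Subtype.val ⁻¹' C : Set O) := hh
    obtain ⟨g, hg, hgU⟩ := Set.mem_iUnion₂.1 (ht hφh)
    obtain ⟨w, ⟨v, hv, rfl⟩, hφw⟩ := hgU
    have hz : (g * v)⁻¹ * h ∈ epsCentralizer ε δ' := hstab (g * v) h hφw.symm
    refine Set.mem_iUnion₂.2 ⟨g, hg, ⟨(v, (g * v)⁻¹ * h), ⟨interior_subset hv, hz⟩, ?_⟩⟩
    show g * v * ((g * v)⁻¹ * h) = h
    rw [mul_inv_cancel_left]
  have hbig : IsCompact (⋃ g ∈ t, (fun p : GL (Fin N) K × GL (Fin N) K => g * p.1 * p.2) ''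
      (V ×ˢ ((epsCentralizer ε δ' : Subgroup (GL (Fin N) K)) : Set (GL (Fin N) K)))) :=
    t.finite_toSet.isCompact_biUnion fun g _ => hpiece g
  have hclosed : IsClosed ((fun g : GL (Fin N) K => g * δ' * (ε g)⁻¹) ⁻¹' C) :=
    hC.isClosed.preimage ((continuous_id.mul continuous_const).mul hε.inv)
  have hcpt₀ : IsCompact ((fun g : GL (Fin N) K => g * δ' * (ε g)⁻¹) ⁻¹' C) := hbig.of_isClosed_subset hclosed hsub
  -- `g ↦ g⁻¹ δ′ ε(g)` is `φ ∘ (·)⁻¹`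
  have hFeq : (fun g : GL (Fin N) K => g⁻¹ * δ' * ε g) ⁻¹' C = ((fun g : GL (Fin N) K => g * δ' * (ε g)⁻¹) ⁻¹' C)⁻¹ := by
    ext g
    simp only [Set.mem_preimage, Set.mem_inv, map_inv, inv_inv]
  rw [hFeq]
  exact hcpt₀.inv

omit [(Valued.v : Valuation K ℤᵐ⁰).Compatible] in
/-- **(T4.0c) THE CONSUMER-FACING FINITENESS** (`twistedShell_finite_of_compactSpace_epsCentralizer` = (T4.0b) ∘ (T4.0a); SHEET v2 8dacb7777119425b §1 :110–:118 VERBATIM):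
for `GL_N(K)` locally compact second countable with `K̃ = GL_N(𝒪)` compact open, a continuous twisting endomorphism `ε` agreeing with `Θ_σ` pointwise (★ K1∕J1′ letter `hεΘ`), a
COMPACT ε-centraliser `G̃_{δ′ε}` (★ `epsCentralizer`; elliptic `Nδ′`) and a CLOSED twisted orbit, EVERY twisted shell `Shell(δ′, a)` is finite — the one hypothesis-set every VALUE
consumer carries (`hfin` of ★ J1′∕K7∕K8).  Proof: the Cartan shell `K̃ϖ^aK̃` is compact (`IsCompact.mul`), its preimage under the twisted orbit map is compact by (T4.0b)
(after rewriting `Θ_σ = ε` pointwise), and (T4.0a) concludes. [cite: Kottwitz1986BaseChangeUnits, §1 p. 240] [cite: Rogawski1990, §4.10 p. 56] -/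
theorem twistedShell_finite_of_compactSpace_epsCentralizer [LocallyCompactSpace (GL (Fin N) K)] [SecondCountableTopology (GL (Fin N) K)]
    (hKo : IsOpen (glInt N K : Set (GL (Fin N) K))) (hKc : IsCompact (glInt N K : Set (GL (Fin N) K)))
    (ε : GL (Fin N) K →* GL (Fin N) K) (hεΘ : ∀ g, ε g = UnitaryGroup.qsInvolution σ g) (hε : Continuous ⇑ε) (δ' : GL (Fin N) K)
    [CompactSpace (epsCentralizer ε δ')] (horb : IsClosed (Set.range fun g : GL (Fin N) K => g⁻¹ * δ' * ε g)) (a : Fin N → ℤ) :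
    {q : GL (Fin N) K ⧸ glInt N K |
      q.out⁻¹ * δ' * UnitaryGroup.qsInvolution σ q.out ∈
        (glInt N K : Set (GL (Fin N) K)) * {zpowDiagGL hϖ.ne_zero a} * (glInt N K : Set (GL (Fin N) K))}.Finite := by
  -- the Cartan shell `K̃ ϖ^a K̃` is compact, so its preimage under the twisted orbit map is compact by (T4.0b)
  have hCc : IsCompact ((glInt N K : Set (GL (Fin N) K)) * {zpowDiagGL hϖ.ne_zero a} * (glInt N K : Set (GL (Fin N) K))) :=
    (hKc.mul isCompact_singleton).mul hKc
  have hfun : (fun g : GL (Fin N) K => g⁻¹ * δ' * UnitaryGroup.qsInvolution σ g) = fun g : GL (Fin N) K => g⁻¹ * δ' * ε g :=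
    funext fun g => by rw [hεΘ]
  refine twistedShell_finite_of_isCompact_preimage hϖ δ' a hKo ?_
  rw [hfun]
  exact isCompact_preimage_twistedConj_of_isClosed_range ε hε δ' horb hCc

end Finite

end Summit.HodgeConjecture.HodgeConjecture.R90.S6

end
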